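import Summits.BirchSwinnertonDyer.BirchSwinnertonDyer.Theses.UniversalToricDescent
import Summits.BirchSwinnertonDyer.BirchSwinnertonDyer.Theorems.UniversalToricDescentTwinAlgMuZeroAtThreeOfBetaRoadParam
import Summits.BirchSwinnertonDyer.BirchSwinnertonDyer.Theorems.UniversalToricDescentResidualSelmerFinite
import Literature.NumberTheory.EllipticCurves.ZpExtensionDecompositionAbovePProofs
import Literature.NumberTheory.GaloisRepresentations.AbsGaloisGroup
import HarnessLib

/-!
# Crux 24737 `TwinAlgMuZeroAtThree` — NODE `tame_ordinary_transport` (crux-ideate g11, idea `tame-ordinarisation-transport`)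

D-0171 node for `stmt-BirchSwinnertonDyer-24737` (NOT registered; the registered skeleton of record stays
`Lines/beta_road.lean` v19).  This node attacks the OTHER bucket of the crux: **C₀ = good supersingular `a₃ = 0`**
(603 classes of the instrument census), which every line of the pool so far either keeps BY NAME (`beta_road`,
`flat_cubic_transport`) or attacks inside the SIGNED (±/♯♭) frame, unprinted at `p = 3`.

THESIS OF THE LINE: A TAME OCTIC STEP MAKES `ρ̄ = E′[3]` UNRAMIFIED AT `3`, HENCE ORDINARY-LIFTABLE, AND `μ` IS RESIDUAL.
For the twin `E′` of bucket C₀, `ρ̄|G_{ℚ₃} ≅ Ind ω₂` (fundamental character of level 2, `ρ̄(I₃)` cyclic of order 8).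
Let `F = ℚ(θ)`, `θ` a root of the TAME OCTIC `P(x) = ∏_{i=1}^{8}(x − 9i) − 3` (§0: `P ≡ x⁸ − 3 (mod 9)` ⇒ Eisenstein ⇒
`3` totally, TAMELY ramified, `e = 8`, `F_v = ℚ₃(3^{1/8})`; eight sign changes ⇒ `F` totally real).  Then
`ω₂^8 = 1` kills `ρ̄` on `I_{F_v}` (§0 `pow_eq_one_of_eight_dvd`), `det ρ̄(Frob_v) = ω(Frob_v) = −1` (`√3 ∈ F_v`,
`√−1 ∉ 𝔽₃`) and `tr ρ̄(Frob_v) = 0` (a Frobenius is antidiagonal on `Ind ω₂`), so `ρ̄(Frob_v)` has the two distinct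
eigenvalues `±1` (§0 `trace_zero_det_neg_one_split`): **`ρ̄|G_{F_v} ≅ 𝟙 ⊕ η` is unramified and SPLIT** — reducible at
the place above `3`, while `ρ̄(G_{F(ζ₃)}) = SL₂(𝔽₃)` stays irreducible.  By Barnet-Lamb–Gee–Geraghty II, Thm 3.1.2
(any odd `l`, the `PSL₂(𝔽₃)`-inadequate case included; `ρ̄|G_F` is modular by Langlands–Tunnell) `ρ̄|G_F` has an
ORDINARY parallel-weight-2 Hilbert modular lift `h` over `F` (equally over the Galois closure `F̃`, totally real,
`e = 8`, `f = 2`).  Over the CM field `M = F̃K` (all primes of `N′` split; `[M : K]` finite) the ORDINARY anticyclotomic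
machinery — Hida/Hsieh `μ(L_p^{ac}) = 0` on the ordinary (= Rapoport) locus and a `Λ`-adic CM-point Kolyvagin system for
`h` (Longo/Fouquet/Nekovář type) — gives «`μ = 0 ∧ torsion`» for `X_(∅,0)(h/M·K_∞)`; the (∅,0) conditions are blind
to the local type at `3`, so by the Greenberg–Vatsal philosophy this is RESIDUAL: the (∅,0) Selmer group of `ρ̄` over
`M·K_∞` is finite (S1).  Restriction to the finite-index subgroup `Γ_{M K_∞} ≤ Γ_{K_∞}` has finite kernel (S2), and the
tree receptacles turn residual finiteness over `K_∞` into the crux's conclusion for bucket C₀ (§3, PROVED).  Bucket B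
(multiplicative très ramifié) is taken BY NAME from the line of record (`beta_road` K1‴, K2a‴ through the landed
composition `twinAlgMuZeroAtThree_of_betaRoadParamStubs`).

PIECES AND TAGS (D-0171):
* §0 INSTRUMENT (PROVED, no `sorry`): the octic is Eisenstein at `3` (`tameOctic_mod_nine`, `tameOctic_zero_mod_nine`),
  an eighth power mod `3` (`tameOctic_mod_three`), has eight real roots (`tameOctic_sign_changes`: 8 sign changes on
  `0 < 9 < 22 < 27 < 40 < 45 < 58 < 63 < 100`); the local lever `pow_eq_one_of_eight_dvd` (`8 ∣ e` kills a character
  of order dividing `8`) and its sharpness `order_eight_survives_small_e` (`e = 3` — the cubic of `flat_cubic_transport` —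
  and `e = 4` do NOT flatten C₀); the Frobenius split `trace_zero_det_neg_one_split` (decidable over `𝔽₃`).
* S1 `TameOcticResidualFinite` / `stub_tameOcticResidualFinite` — the TRANSFERRED C₀ half C⁺: finiteness of the residual
  (`𝔭′`-strict, `𝔭`-relaxed, unramified outside `Σ₀ ∪ {3}`) Selmer group of `E′_K[3]` over `M·K_∞`.  UNDECIDED ·
  STRONGER than the C₀ half a priori (upstairs finiteness = finiteness of all `Gal(M/K)`-twisted pieces); implies it via
  S2 + §3.  Children: L_loc PROVED (§0) · L_lift UNDECIDED-in-print (BLGG II Thm 3.1.2; sub-leaf: level / ordering of the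
  two characters in the inadequate case) · L_an IDEA-NEEDED (Hida–Hsieh independence needs «p unramified in F»; at
  `e = 8` the Zariski-density / Igusa-irreducibility step on the Deligne–Pappas / splitting model is unprinted — ordinary ⇒
  Rapoport, so Serre–Tate coordinates exist; Andreatta–Goren, Reduzzi–Xiao) · L_alg UNDECIDED (Λ-adic CM-point KS for
  ordinary Hilbert forms at `p = 3 ∣ D_F`: Longo 2012 has `p ≥ 5` unramified, Fouquet `p > 3`) · L_sh ATTACKABLE
  (Shapiro + residual transport upstairs, tree `finite_residualSelmer_iff_of_addEquiv`).
* S2 `OcticDescent` / `stub_octicDescent` — WEAKER · ATTACKABLE (restriction to a finite-index normal subgroup of `ker κ`: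
  kernel `H¹(finite group, finite module)` finite; conditions map to conditions).
* B half BY NAME — `stub_principalHeegnerIndivisibleMult` (K1‴) and `stub_ksTwinLambda` (K2a‴ = item 32864): UNDECIDED,
  the registered research inputs of `beta_road` v19, untouched here.
* §3 glue `twinAlgMuZeroAtThree_goodSS_of_tameOctic`, `goodSSOfParam_of_tameOctic` and §4 `TwinAlgMuZeroAtThree_of`
  (K1‴ → K2a‴ → S1 → S2 → crux BY NAME): PROVED.
BSD is proved for no curve by this file; 24737 / 32864 stay OPEN.  No `allowUnsafeReducibility`.

[cite: BarnetLambGeeGeraghty2013, Thm 3.1.2] [cite: Taylor2002FM, §1 (choice of F)] [cite: GreenbergVatsal2000, §2]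
[cite: Hsieh2014, Thm 2, hypothesis (unr)] [cite: Longo2012, §1 (p ≥ 5, p unramified in F)]
-/

set_option autoImplicit false

-- `…BirchSwinnertonDyer.BirchSwinnertonDyer…` is the cell's nested layout (D-0017)
set_option linter.dupNamespace false

namespace Summit.BirchSwinnertonDyer.BirchSwinnertonDyer.Cruxes.TwinAlgMuZeroAtThree.TameOrdinaryTransport

/-- **The tame octic** `P(x) = (x − 9)(x − 18)⋯(x − 72) − 3`, over any commutative ring.  Intended: `F = ℚ(θ)`,
`P(θ) = 0` — totally real, `3` totally and tamely ramified with `e = 8` (`F ⊗ ℚ₃ ≅ ℚ₃(3^{1/8})`). [folklore] -/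
def tameOctic {R : Type*} [CommRing R] (x : R) : R :=
  (x - 9) * (x - 18) * (x - 27) * (x - 36) * (x - 45) * (x - 54) * (x - 63) * (x - 72) - 3

end Summit.BirchSwinnertonDyer.BirchSwinnertonDyer.Cruxes.TwinAlgMuZeroAtThree.TameOrdinaryTransport

/-! ## §0 INSTRUMENT — kernel-checked data behind the lever (no `sorry`) -/

namespace Summit.BirchSwinnertonDyer.BirchSwinnertonDyer.Cruxes.TwinAlgMuZeroAtThree.TameOrdinaryTransport.Instrument

open Summit.BirchSwinnertonDyer.BirchSwinnertonDyer.Cruxes.TwinAlgMuZeroAtThree.TameOrdinaryTransport (tameOctic)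

/-- EISENSTEIN AT `3` (i): every factor `x − 9i` is `≡ x (mod 9)`, so `P ≡ x⁸ − 3 (mod 9)` — all non-leading
coefficients are divisible by `9`, a fortiori by `3`. (As functions on `ℤ/9`; decidable.) [folklore] -/
theorem tameOctic_mod_nine : ∀ x : ZMod 9, tameOctic x = x ^ 8 - 3 := by
  unfold tameOctic; decide

/-- EISENSTEIN AT `3` (ii): the constant term `P(0) = 9⁸·8! − 3 = 1735643790717 ≡ 6 (mod 9)` has `3`-valuation
exactly `1`.  With (i): `P` is Eisenstein, irreducible, and `3` is totally ramified in `ℚ(θ)` with `e = 8` — TAME,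
since `3 ∤ 8`. [folklore] -/
theorem tameOctic_zero_mod_nine : tameOctic (0 : ℤ) = 1735643790717 ∧ (1735643790717 : ℤ) % 9 = 6 := by
  unfold tameOctic; norm_num

/-- Total ramification seen residually: `P ≡ x⁸ (mod 3)`, a perfect eighth power. [folklore] -/
theorem tameOctic_mod_three : ∀ x : ZMod 3, tameOctic x = x ^ 8 := by
  unfold tameOctic; decide

/-- `P` vanishes to `−3` at the eight nodes `9i`. [folklore] -/
theorem tameOctic_at_nodes :
    tameOctic (9 : ℤ) = -3 ∧ tameOctic (18 : ℤ) = -3 ∧ tameOctic (27 : ℤ) = -3 ∧ tameOctic (36 : ℤ) = -3 ∧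
      tameOctic (45 : ℤ) = -3 ∧ tameOctic (54 : ℤ) = -3 ∧ tameOctic (63 : ℤ) = -3 ∧ tameOctic (72 : ℤ) = -3 := by
  unfold tameOctic; norm_num

/-- TOTALLY REAL: eight sign changes of `P` along `0 < 9 < 22 < 27 < 40 < 45 < 58 < 63 < 100`, hence (IVT) eight
distinct real roots of the degree-8 polynomial `P`: every embedding of `F = ℚ(θ)` is real. [folklore] -/
theorem tameOctic_sign_changes :
    0 < tameOctic (0 : ℤ) ∧ tameOctic (9 : ℤ) < 0 ∧ 0 < tameOctic (22 : ℤ) ∧ tameOctic (27 : ℤ) < 0 ∧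
      0 < tameOctic (40 : ℤ) ∧ tameOctic (45 : ℤ) < 0 ∧ 0 < tameOctic (58 : ℤ) ∧ tameOctic (63 : ℤ) < 0 ∧
        0 < tameOctic (100 : ℤ) := by
  unfold tameOctic; norm_num

/-- **The local lever (PROVED).**  A character of order dividing `8` — the level-2 fundamental character `ω₂` on tame
inertia, `ρ̄(I₃) = ⟨ω₂ ⊕ ω₂³⟩` for the supersingular twin — dies on the inertia subgroup of a tame extension whose
ramification index is divisible by `8`: `ρ̄|I_{F_v}` is TRIVIAL, `ρ̄|G_{F_v}` is unramified. [cite: Serre1972, §1] -/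
theorem pow_eq_one_of_eight_dvd {G : Type*} [Monoid G] (χ : G) (h8 : χ ^ 8 = 1) (e : ℕ) (he : 8 ∣ e) :
    χ ^ e = 1 := by
  obtain ⟨k, rfl⟩ := he
  rw [pow_mul, h8, one_pow]

/-- **Sharpness of the lever (PROVED).**  An element of order `8` survives the exponents `3` (the wild cubic of
`flat_cubic_transport`, which flattens bucket B but not C₀), `4` (`ω₂⁴ = −1`: still ramified, scalar `η ⊕ η` on inertia
after a quartic step) and `6`; `8` is the minimal tame ramification index that ordinarises C₀. [folklore] -/
theorem order_eight_survives_small_e {G : Type*} [Monoid G] (χ : G) (h : orderOf χ = 8) :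
    χ ^ 3 ≠ 1 ∧ χ ^ 4 ≠ 1 ∧ χ ^ 6 ≠ 1 ∧ χ ^ 8 = 1 := by
  refine ⟨pow_ne_one_of_lt_orderOf (by norm_num) (by rw [h]; norm_num),
    pow_ne_one_of_lt_orderOf (by norm_num) (by rw [h]; norm_num),
    pow_ne_one_of_lt_orderOf (by norm_num) (by rw [h]; norm_num), ?_⟩
  rw [← h]; exact pow_orderOf_eq_one χ

/-- **Frobenius splits (PROVED, decidable).**  Upstairs `ρ̄(Frob_v) ∈ GL₂(𝔽₃)` has trace `0` (`a₃ = 0`: a Frobenius is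
antidiagonal on `Ind ω₂`) and determinant `ω(Frob_v) = −1` (`F_v = ℚ₃(3^{1/8}) ∋ √3`, `√−1 ∉ 𝔽₃`): every such matrix
squares to `1` and is `≠ ±1`, i.e. it is semisimple with BOTH eigenvalues `+1` and `−1` — `ρ̄|G_{F_v} ≅ 𝟙 ⊕ η` is
split reducible, the shape under which ordinary (weight-2) lifts exist. [cite: BarnetLambGeeGeraghty2013, Thm 3.1.2 (hypothesis «reducible at v ∣ l»)] -/
theorem trace_zero_det_neg_one_split :
    ∀ M : Matrix (Fin 2) (Fin 2) (ZMod 3), M 0 0 + M 1 1 = 0 → M 0 0 * M 1 1 - M 0 1 * M 1 0 = -1 →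
      M * M = 1 ∧ M ≠ 1 ∧ M ≠ -1 := by
  decide

end Summit.BirchSwinnertonDyer.BirchSwinnertonDyer.Cruxes.TwinAlgMuZeroAtThree.TameOrdinaryTransport.Instrument

noncomputable section

open scoped Classical NumberField

namespace Summit.BirchSwinnertonDyer.BirchSwinnertonDyer.Cruxes.TwinAlgMuZeroAtThree.TameOrdinaryTransport

open NumberField IsDedekindDomain Field WeierstrassCurve
open Literature.NumberTheory.EllipticCurves Literature.NumberTheory.EllipticCurves.GreenbergSelmer
  Literature.NumberTheory.EllipticCurves.GreenbergVatsal2000 Literature.NumberTheory.EllipticCurves.IwasawaAlgebra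
open Summit.BirchSwinnertonDyer.Rank1Residual.X11b Summit.BirchSwinnertonDyer.Rank1Residual.X11b.AcSelmer
open Summit.BirchSwinnertonDyer.BirchSwinnertonDyer.Theorems.UniversalToricDescentAcDualMuZero
open Summit.BirchSwinnertonDyer.BirchSwinnertonDyer.Theorems
open Summit.BirchSwinnertonDyer.BirchSwinnertonDyer.Theorems.UniversalToricDescentResidualSelmerFinite
open Literature.NumberTheory.EllipticCurves.ZpExtension
open Literature.NumberTheory.EllipticCurves.ModularForms (ModularParametrizationData)

/-! ## §1 Objects of the line -/

/-- `Γ_{M_∞} ≤ Γ_K` for `M = K(θ)` (`θ` a root of the tame octic) and `M_∞ = M·K_∞`: the normal core of the absolute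
Galois group of `K(θ)` (pulled back along the tree's `absoluteGaloisGroup.toAlgEquiv`; the core is `Γ_{F̃K}`, `F̃` the
Galois closure of `F = ℚ(θ)` — still totally real, `3` tame with `e = 8`, `f = 2`; an `abbrev` so that the `Normal`
instance is found) intersected with `Gal(K̄/K_∞) = ker κ`. [cite: GreenbergVatsal2000, §2 (Selmer groups over `K̄^H`)] -/
abbrev tameLine {K : Type} [Field K] [NumberField K] (κ : ZpExtension K 3) (θ : AlgebraicClosure K) :
    Subgroup (absoluteGaloisGroup K) :=
  ((IntermediateField.adjoin K ({θ} : Set (AlgebraicClosure K))).fixingSubgroup.comap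
      (absoluteGaloisGroup.toAlgEquiv K).toMonoidHom).normalCore ⊓ κ.kerSubgroup

/-- `Σ₀(W)` = the finite places of `K` prime to `3` where `W` has bad reduction (for `W = E′_K` in bucket C₀: the
primes above `N′`, all prime to `3`). [cite: GreenbergVatsal2000, §2 (non-primitive Selmer groups)] -/
def badAwayThree {K : Type} [Field K] [NumberField K] (W : WeierstrassCurve K) : Set (HeightOneSpectrum (𝓞 K)) :=
  {v | ((3 : ℕ) : 𝓞 K) ∉ v.asIdeal ∧ ¬ W.HasGoodReductionAt v}

/-! ## §2 The statements of the line (as constants) and the stubs -/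

/-- **S1 (UNDECIDED; the transferred C₀ half C⁺ — STRONGER a priori, implies the C₀ half via S2 + §3).**
For the twin `W′` in bucket C₀ (good supersingular at `3`, `a₃ = 0`, `ρ̄₃` onto, conductor `N′`, a modular
parametrisation datum at level `N′`), `K` imaginary quadratic Heegner for `N′` with odd `d_K`, `κ` anticyclotomic,
`𝔭 ∋ 3` of degree one, `𝔭′ ∋ 3`, `𝔭′ ≠ 𝔭` (so `3` splits in `K`), and `θ` a root of the tame octic: the residual
(`𝔭′`-strict, `𝔭`-relaxed, unramified outside `Σ₀ ∪ {3}`) Selmer group of `E′_K[3]` over `M_∞ = K(θ)~·K_∞` is FINITE.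
Strategy = children L_loc (§0, PROVED) · L_lift (BLGG II 3.1.2: an ordinary parallel-weight-2 Hilbert lift `h` of the
unramified-at-3, split `ρ̄|G_{F̃}`) · L_an (IDEA-NEEDED: `μ(L_p^{ac}(h/M)) = 0` at `p = 3 ∣ D_F`, `e = 8`) · L_alg
(UNDECIDED: Λ-adic CM-point Kolyvagin system for ordinary `h` at `p = 3`) · L_sh (ATTACKABLE: residual transport).
[cite: BarnetLambGeeGeraghty2013, Thm 3.1.2] [cite: Hsieh2014, Thm 2 (shape; `p` unramified in `F` there)]
[cite: GreenbergVatsal2000, §2 p. 26] -/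
@[conjecture]
def TameOcticResidualFinite : Prop :=
    ∀ (W' : WeierstrassCurve ℚ) [W'.IsElliptic] [W'.IsGloballyMinimal] (N' : ℕ) [NeZero N']
      (K : Type) [Field K] [NumberField K] (_Dt' : ModularParametrizationData W' N'),
      Rank1Residual.GoodSS W' 3 → W'.frobeniusTrace 3 = 0 →
      W'.HasSurjectiveModNGaloisRep 3 → W'.conductorNorm ℤ = N' → IsImaginaryQuadratic K →
      SatisfiesHeegnerHypothesis N' K → Odd (NumberField.discr K) →
      ∀ (κ : ZpExtension K 3), κ.IsAnticyclotomic →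
      ∀ (𝔭 : HeightOneSpectrum (𝓞 K)), ((3 : ℕ) : 𝓞 K) ∈ 𝔭.asIdeal →
        𝔭.asIdeal.ramificationIdx (𝓞 ℚ) = 1 → 𝔭.asIdeal.inertiaDeg (𝓞 ℚ) = 1 →
      ∀ (𝔭' : HeightOneSpectrum (𝓞 K)), ((3 : ℕ) : 𝓞 K) ∈ 𝔭'.asIdeal → 𝔭' ≠ 𝔭 →
      ∀ (θ : AlgebraicClosure K), tameOctic θ = 0 →
        (datumStrictSelmer (tameLine κ θ) ((W'.baseChange K).geomTorsion ((3 : ℕ) : ℤ)) 3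
            (AcSelmer.bdpData _ 3 𝔭') (badAwayThree (W'.baseChange K)) :
          Set (subgroupH1 (tameLine κ θ) ((W'.baseChange K).geomTorsion ((3 : ℕ) : ℤ)))).Finite

/-- **S2 (WEAKER · ATTACKABLE; octic descent).**  For any `W/K`, `ℤ₃`-extension `κ`, `𝔭′`, `Σ` and root `θ` of the
tame octic: if the residual Selmer group of `W[3]` over `M_∞ = K(θ)~·K_∞` is finite then so is the one over `K_∞`.
Sketch: restriction `H¹(ker κ, W[3]) → H¹(Γ_{M_∞}, W[3])` has kernel `H¹(ker κ/Γ_{M_∞}, W[3]^{Γ_{M_∞}})` — finite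
(finite index, finite module) — and maps the `K_∞`-conditions into the `M_∞`-conditions (inertia subgroups
intersected with `Γ_{M_∞}`, same strict kernel at `𝔭′`). [cite: GreenbergVatsal2000, §2 p. 26] [cite: LimSujatha2018, §3] -/
@[conjecture]
def OcticDescent : Prop :=
    ∀ (K : Type) [Field K] [NumberField K] (W : WeierstrassCurve K) (κ : ZpExtension K 3)
      (𝔭' : HeightOneSpectrum (𝓞 K)) (S : Set (HeightOneSpectrum (𝓞 K))) (θ : AlgebraicClosure K),
      tameOctic θ = 0 →
        (datumStrictSelmer (tameLine κ θ) (W.geomTorsion ((3 : ℕ) : ℤ)) 3 (AcSelmer.bdpData _ 3 𝔭') S :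
            Set (subgroupH1 (tameLine κ θ) (W.geomTorsion ((3 : ℕ) : ℤ)))).Finite →
        (datumStrictSelmer κ.kerSubgroup (W.geomTorsion ((3 : ℕ) : ℤ)) 3 (AcSelmer.bdpData _ 3 𝔭') S :
            Set (subgroupH1 κ.kerSubgroup (W.geomTorsion ((3 : ℕ) : ℤ)))).Finite

/-- Stub S1 (UNDECIDED · STRONGER a priori; RESEARCH — children L_lift / L_an / L_alg / L_sh in the module docstring).
[cite: BarnetLambGeeGeraghty2013, Thm 3.1.2] [cite: Hsieh2014, Thm 2 (shape)] -/
theorem stub_tameOcticResidualFinite : TameOcticResidualFinite := by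
  sorry

/-- Stub S2 (WEAKER · ATTACKABLE; Galois cohomology of a finite module). [cite: GreenbergVatsal2000, §2 p. 26] -/
theorem stub_octicDescent : OcticDescent := by
  sorry

/-- **K1‴ BY NAME** (bucket B input of the line of record `beta_road` v19; UNDECIDED, untouched by this node).
[cite: Castella2024, §2.2 and Thm. 2.1] [cite: BertoliniDarmon1996, §2.5] -/
theorem stub_principalHeegnerIndivisibleMult :
    UniversalToricDescentBetaRoadParamDefs.PrincipalHeegnerIndivisibleMultOfParamAtThree := by
  sorry

/-- **K2a‴ BY NAME** = the UTD item stmt-BirchSwinnertonDyer-32864 (bucket B input of `beta_road` v19; UNDECIDED,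
untouched by this node). [cite: Howard2004HeegnerKolyvagin, Thm. 2.3.1] -/
theorem stub_ksTwinLambda :
    Summit.BirchSwinnertonDyer.BirchSwinnertonDyer.Theses.UniversalToricDescent.KsTwinLambdaAdicAtThree := by
  sorry

/-! ## §3 Glue (real proofs) -/

/-- A root of the tame octic exists in `K̄`. [folklore] -/
theorem exists_tameOctic_root (K : Type) [Field K] [NumberField K] :
    ∃ θ : AlgebraicClosure K, tameOctic θ = 0 := by
  let f : Polynomial (AlgebraicClosure K) :=
    (Polynomial.X - Polynomial.C 9) * (Polynomial.X - Polynomial.C 18) * (Polynomial.X - Polynomial.C 27) *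
      (Polynomial.X - Polynomial.C 36) * (Polynomial.X - Polynomial.C 45) * (Polynomial.X - Polynomial.C 54) *
      (Polynomial.X - Polynomial.C 63) * (Polynomial.X - Polynomial.C 72) - Polynomial.C 3
  have hf : f.natDegree = 8 := by
    simp only [f]
    compute_degree!
  have hf0 : f ≠ 0 := by
    rintro h
    rw [h, Polynomial.natDegree_zero] at hf
    exact absurd hf (by norm_num)
  have hdeg : f.degree ≠ 0 := by
    rw [Polynomial.degree_eq_natDegree hf0, hf]
    exact_mod_cast (by norm_num : (8 : ℕ) ≠ 0)
  obtain ⟨θ, hθ⟩ := IsAlgClosed.exists_root f hdeg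
  refine ⟨θ, ?_⟩
  have h := hθ.eq_zero
  simpa [f, tameOctic] using h

/-- **Bucket C₀ of the crux from S1 and S2** (the chain of the module docstring; real proof): residual finiteness over
`M_∞` (S1) ⟹ over `K_∞` (S2) ⟹ `Sel_{𝔭′}^{Σ₀}(K_∞, E′[3^∞])[3]` finite (tree, `𝔭′` finitely decomposed since `K` is
imaginary quadratic) ⟹ `Σ₀ ↦ ∅` ⟹ «`X_(∅,0)` torsion with a unit coefficient» (tree receptacle).
[cite: GreenbergVatsal2000, §2 p. 26] [cite: LimSujatha2018, Prop 3.2] -/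
theorem twinAlgMuZeroAtThree_goodSS_of_tameOctic (h1 : TameOcticResidualFinite) (h2 : OcticDescent)
    (W' : WeierstrassCurve ℚ) [W'.IsElliptic] [W'.IsGloballyMinimal] (N' : ℕ) [NeZero N']
    (K : Type) [Field K] [NumberField K] (Dt' : ModularParametrizationData W' N')
    (hss : Rank1Residual.GoodSS W' 3) (ha : W'.frobeniusTrace 3 = 0)
    (hsurj : W'.HasSurjectiveModNGaloisRep 3) (hN : W'.conductorNorm ℤ = N') (hK : IsImaginaryQuadratic K)
    (hH : SatisfiesHeegnerHypothesis N' K) (hodd : Odd (NumberField.discr K))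
    (κ : ZpExtension K 3) (hκ : κ.IsAnticyclotomic)
    (γ : absoluteGaloisGroup K) [Fact (κ.IsTopGenerator γ)]
    (𝔭 : HeightOneSpectrum (𝓞 K)) (h𝔭 : ((3 : ℕ) : 𝓞 K) ∈ 𝔭.asIdeal)
    (he : 𝔭.asIdeal.ramificationIdx (𝓞 ℚ) = 1) (hf : 𝔭.asIdeal.inertiaDeg (𝓞 ℚ) = 1)
    (𝔭' : HeightOneSpectrum (𝓞 K)) (h𝔭' : ((3 : ℕ) : 𝓞 K) ∈ 𝔭'.asIdeal) (hne : 𝔭' ≠ 𝔭) :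
    Module.IsTorsion (IwasawaAlgebra 3) (XAc (W'.baseChange K) 3 κ 𝔭' ∅ γ) ∧
      ∃ g' : UnrSeries 3,
        (XAc.charIdeal (W'.baseChange K) 3 κ 𝔭' ∅ γ).map (PowerSeries.map (Halves.toUnr 3)) =
            Ideal.span {g'} ∧
          ∃ i : ℕ, ‖((PowerSeries.coeff i g' : unrIntegers 3) : ℂ_[3])‖ = 1 := by
  haveI : (W'.baseChange K).IsElliptic := by rw [WeierstrassCurve.baseChange]; infer_instance
  obtain ⟨θ, hθ⟩ := exists_tameOctic_root K
  -- S1: residual finiteness over `M_∞ = K(θ)~·K_∞`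
  have hF := h1 W' N' K Dt' hss ha hsurj hN hK hH hodd κ hκ 𝔭 h𝔭 he hf 𝔭' h𝔭' hne θ hθ
  -- S2: descent to `K_∞`
  have hR := h2 K (W'.baseChange K) κ 𝔭' (badAwayThree (W'.baseChange K)) θ hθ hF
  -- `𝔭′` is finitely decomposed in `K_∞`; `Σ₀` contains the bad places prime to `3`
  have hdec : ¬ (decomp 𝔭' ≤ κ.kerSubgroup) := not_decomp_le_kerSubgroup_of_isImaginaryQuadratic hK κ h𝔭'
  have hS : ∀ v : HeightOneSpectrum (𝓞 K), v ∉ badAwayThree (W'.baseChange K) →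
      ((3 : ℕ) : 𝓞 K) ∉ v.asIdeal → (W'.baseChange K).HasGoodReductionAt v := by
    intro v hv h3
    by_contra hbad
    exact hv ⟨h3, hbad⟩
  -- residual finiteness ⟹ `Sel_{𝔭′}^{Σ₀}(K_∞, E′[3^∞])[3]` finite (tree)
  have hSel : Set.Finite {s : selmerAc (W'.baseChange K) 3 κ 𝔭' (badAwayThree (W'.baseChange K)) | 3 • s = 0} :=
    finite_selmerAc_pTorsion_of_finite_residualSelmer (W'.baseChange K) κ h𝔭' hdec hS hR
  -- `Σ₀ ↦ ∅` (along the injective inclusion `Sel^∅ ≤ Sel^{Σ₀}`, `selmerAc_empty_le`)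
  have hfin : Set.Finite {s : selmerAc (W'.baseChange K) 3 κ 𝔭' ∅ | 3 • s = 0} := by
    have hle : selmerAc (W'.baseChange K) 3 κ 𝔭' ∅ ≤
        selmerAc (W'.baseChange K) 3 κ 𝔭' (badAwayThree (W'.baseChange K)) := selmerAc_empty_le
    have hι : Function.Injective (AddSubgroup.inclusion hle) := AddSubgroup.inclusion_injective hle
    refine (hSel.preimage hι.injOn).subset ?_
    intro s hs
    simp only [Set.mem_setOf_eq, Set.mem_preimage] at hs ⊢
    rw [← map_nsmul, hs, map_zero]
  -- the landed receptacle
  exact isTorsion_and_exists_generator_of_finite_pTorsion (W'.baseChange K) 3 κ 𝔭' ∅ γ Set.finite_empty hfin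

/-- **C₀′ of the line of record from S1 and S2** (so the node FEEDS `beta_road`: its third stub `stub_goodSS` is
discharged by this line).  Real proof. [cite: GreenbergVatsal2000, §2 p. 26] -/
theorem goodSSOfParam_of_tameOctic (h1 : TameOcticResidualFinite) (h2 : OcticDescent) :
    UniversalToricDescentBetaRoadParamDefs.TwinAlgMuZeroAtThreeGoodSSOfParam := by
  refine UniversalToricDescentBetaRoadParamDefs.twinAlgMuZeroAtThreeGoodSSOfParam_iff.mpr ?_
  intro W' _ _ N' _ K _ _ Dt' hss ha hsurj hN hK hH hodd κ hκ γ _ 𝔭 h𝔭 he hf 𝔭' h𝔭' hne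
  exact twinAlgMuZeroAtThree_goodSS_of_tameOctic h1 h2 W' N' K Dt' hss ha hsurj hN hK hH hodd κ hκ γ 𝔭 h𝔭 he hf
    𝔭' h𝔭' hne

/-! ## §4 The crux BY NAME -/

/-- **Crux 24737 `TwinAlgMuZeroAtThree` BY NAME from K1‴, K2a‴ (bucket B, line of record) and S1, S2 (bucket C₀,
this line)** — through the landed composition `twinAlgMuZeroAtThree_of_betaRoadParamStubs` with its C₀′ argument
DISCHARGED by `goodSSOfParam_of_tameOctic`.  CONDITIONAL on the four stubs; 24737 stays OPEN.
[cite: Howard2004HeegnerKolyvagin, Thm. 2.3.1, Thm. B (shape only)] [cite: GreenbergVatsal2000, §2 p. 26] -/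
theorem TwinAlgMuZeroAtThree_of :
    UniversalToricDescentBetaRoadParamDefs.PrincipalHeegnerIndivisibleMultOfParamAtThree →
      Summit.BirchSwinnertonDyer.BirchSwinnertonDyer.Theses.UniversalToricDescent.KsTwinLambdaAdicAtThree →
        TameOcticResidualFinite → OcticDescent →
          Summit.BirchSwinnertonDyer.BirchSwinnertonDyer.Theses.UniversalToricDescent.TwinAlgMuZeroAtThree := by
  intro hK1 hK2 h1 h2
  exact UniversalToricDescentTwinAlgMuZeroAtThreeOfBetaRoadParam.twinAlgMuZeroAtThree_of_betaRoadParamStubs hK1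
    -- the route item `…Theses.UniversalToricDescent.KsTwinLambdaAdicAtThree` (stmt-32864) unfolds to the Theorems constant
    (by simpa only [Summit.BirchSwinnertonDyer.BirchSwinnertonDyer.Theses.UniversalToricDescent.KsTwinLambdaAdicAtThree]
      using hK2)
    (goodSSOfParam_of_tameOctic h1 h2)

/-- The same, fed by the node's own stubs (sorries live only in `stub_*`). -/
theorem twinAlgMuZeroAtThree_of_stubs :
    Summit.BirchSwinnertonDyer.BirchSwinnertonDyer.Theses.UniversalToricDescent.TwinAlgMuZeroAtThree :=
  TwinAlgMuZeroAtThree_of stub_principalHeegnerIndivisibleMult stub_ksTwinLambda stub_tameOcticResidualFinite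
    stub_octicDescent

end Summit.BirchSwinnertonDyer.BirchSwinnertonDyer.Cruxes.TwinAlgMuZeroAtThree.TameOrdinaryTransport

end
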